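import Mathlib.CategoryTheory.Products.Basic
import Literature.AlgebraicGeometry.Frobenioids.BaseCategoryTheoreticity
import Literature.AlgebraicGeometry.Frobenioids.DivisorMonoidCategoryTheoreticityDefs
import HarnessLib

/-!
# Frobenioids I, §4: Theorem 4.9 (Category-theoreticity of divisor monoids), Corollaries 4.10, 4.11,
# 4.12 (Category-theoreticity of the birationalization / of the functor to an elementary Frobenioid)

Mochizuki, *The geometry of Frobenioids I: the general theory*, Kyushu J. Math. **62** (2008)
293–400, kurims text pp. 88–95 [cite: MochizukiFrdI2008, §4 pp.88-95]. Corollary 4.11 is the most cited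
item of [FrdI] in IUT I–IV (14 citations): it says that the functor `C → F_Φ` defining a Frobenioid of
(rationally) standard type over a Div-slim base is recovered from the abstract category `C`.

Setting: `Φ_i` divisorial monoids on connected, totally epimorphic `D_i`, `C_i → F_{Φ_i}` Frobenioids,
`Ψ : C₁ ⥤ C₂` an equivalence; operations `S_i : PreFrobenioidData C_i D_i` (INTERFACE, `TODO-merge:
abc-iut-found`); every item is a conclusion predicate asserted in print for all Frobenioids with the
printed hypotheses. "Rationally standard type" (Def. 4.5 (iii)) is the structured hypothesis `S_i.IsOfRationallyStandardType R_i`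
over explicit parameters `R_i : RSParams S_i` (birationalization data, support predicate, `C^un-tr` data —
data-only interfaces, faithful when instantiated with THE constructions; no bare `Prop` placeholder). In the operations rendering an "isomorphism of
functors `Ψ^Φ : Φ₁ ⥲ Φ₂` lying over `Ψ`" is a family of monoid isomorphisms
`Φ₁(Base A) ≃* Φ₂(Base (Ψ A))` natural in `A ∈ Ob(C₁)`, and the functor to the elementary Frobenioid
`C → F_Φ` is the triple `(Base, Div, deg_Fr)`; `F_{0_D}` "is the product category of `D` with the
one-object category determined by the monoid `N_{≥1}`" (Prop. 4.4 (i) p. 83), here `D × SingleObj ℕ+`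
with the functor `toBaseDeg` DEFINED.

Contents: Thm. 4.9; Rem. 4.9.1 (refers to Ex. 4.3, examples file); Cor. 4.10; Cor. 4.11 (i)–(iv) (v2, FLAG #15:
`Cor411iv` carries (ii)'s `D`-rigidity only under its slimness premise; print's (iv) rigidity of the
`F_Φ`-valued composites is `Cor411ivRigid`; v3: (iii)'s `Ψ^Prime`-compatibility is `Cor411iii_compat`); Rem. 4.11.1 (PROVED in the form "slim ⇒ Div-slim", see
`isDivSlim_of_isSlim`); Rem. 4.11.2, 4.12.1 (refer to Ex. 3.9, 3.10, examples file); Cor. 4.12. No statement of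
the paper is strengthened.
-/

namespace Literature.AlgebraicGeometry.Frobenioids

open CategoryTheory

universe w w₁ w₂ v v' v₁ v₁' v₂ v₂' u u' u₁ u₁' u₂ u₂'

namespace PreFrobenioidData

section ToBaseDeg

variable {C : Type u} [Category.{v} C] {D : Type u'} [Category.{v'} D]
variable (S : PreFrobenioidData.{w} C D)

/-- The natural projection functor `C → F_{0_D} = D × N_{≥1}` "determined by the Frobenius degree and the
projection to `D`" (FrdI Prop. 4.4 (i) p. 83, Cor. 4.12 p. 95): `A ↦ (Base A, *)`,
`φ ↦ (Base φ, deg_Fr φ)`. [cite: MochizukiFrdI2008, Cor. 4.12 p.95] -/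
def toBaseDeg : C ⥤ D × SingleObj ℕ+ where
  obj A := (S.base.obj A, SingleObj.star ℕ+)
  map φ := (S.base.map φ, S.degFr φ)
  map_id A := by
    ext
    · exact S.base.map_id A
    · change S.degFr (𝟙 A) = 1
      exact S.degFr_id A
  map_comp φ ψ := by
    ext
    · exact S.base.map_comp φ ψ
    · change S.degFr (φ ≫ ψ) = S.degFr ψ * S.degFr φ
      rw [S.degFr_comp, mul_comm]

end ToBaseDeg

variable {C₁ : Type u₁} [Category.{v₁} C₁] {D₁ : Type u₁'} [Category.{v₁'} D₁]
variable {C₂ : Type u₂} [Category.{v₂} C₂] {D₂ : Type u₂'} [Category.{v₂'} D₂]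
variable (S₁ : PreFrobenioidData.{w₁} C₁ D₁) (S₂ : PreFrobenioidData.{w₂} C₂ D₂) (Ψ : C₁ ≌ C₂)

/-- An *isomorphism of functors `Ψ^Φ : Φ₁ ⥲ Φ₂` lying over `Ψ`*, the `Φ_i` regarded as functors on `C_i`
via `Base` (FrdI Thm. 4.9 p. 88): monoid isomorphisms `Φ₁(Base A) ≃ Φ₂(Base Ψ(A))`, natural with respect to
the pull-back maps along arrows of `C₁`. [cite: MochizukiFrdI2008, Thm. 4.9 p.88] -/
structure DivisorMonoidIsoOver where
  /-- the component at `A ∈ Ob(C₁)` -/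
  iso : ∀ A : C₁, S₁.Mon (S₁.base.obj A) ≃* S₂.Mon (S₂.base.obj (Ψ.functor.obj A))
  /-- naturality: `Ψ^Φ_A (Base(φ)^* x) = Base(Ψ φ)^* (Ψ^Φ_B x)` -/
  natural : ∀ ⦃A B : C₁⦄ (φ : A ⟶ B) (x : S₁.Mon (S₁.base.obj B)),
    iso A (S₁.pull (S₁.base.map φ) x) = S₂.pull (S₂.base.map (Ψ.functor.map φ)) (iso B x)

/-- **Theorem 4.9** (Category-theoreticity of divisor monoids): for Frobenioids of rationally standard type
(hypotheses `S_i.IsOfRationallyStandardType R_i`, Def. 4.5 (iii), over explicit parameters `R_i`) there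
exists an isomorphism of functors `Ψ^Φ : Φ₁ ⥲ Φ₂` lying over `Ψ` (FrdI pp. 88–89).
-- TODO(general form): "compatible [when the C_i are isotropic, not group-like] with Ψ^Prime of
-- Thm. 4.2 (ii)" — the compatibility clause is recorded in `Thm49_compat`.
[cite: MochizukiFrdI2008, Thm. 4.9 p.88] -/
def Thm49 (R₁ : S₁.RSParams) (R₂ : S₂.RSParams) : Prop :=
  S₁.IsOfRationallyStandardType R₁ → S₂.IsOfRationallyStandardType R₂ → Nonempty (DivisorMonoidIsoOver S₁ S₂ Ψ)

/-- **Theorem 4.9**, compatibility clause: when `C₁, C₂` are of isotropic but not group-like type, `Ψ^Φ` is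
compatible with `Ψ^Prime` of Thm. 4.2 (ii): `Ψ^Φ_A` maps the submonoid `Φ₁(A)_𝔭` onto `Φ₂(Ψ A)_{Ψ^Prime(𝔭)}`
(FrdI p. 89). [cite: MochizukiFrdI2008, Thm. 4.9 p.89] -/
def Thm49_compat (E : DivisorMonoidIsoOver S₁ S₂ Ψ)
    (e : ∀ A : C₁, Primes (S₁.Mon (S₁.base.obj A)) ≃ Primes (S₂.Mon (S₂.base.obj (Ψ.functor.obj A)))) : Prop :=
  S₁.IsOfIsotropicType → S₂.IsOfIsotropicType → ¬ S₁.IsOfGroupLikeType → ¬ S₂.IsOfGroupLikeType →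
    ∀ (A : C₁) (𝔭 : Primes (S₁.Mon (S₁.base.obj A))) (x : S₁.Mon (S₁.base.obj A)),
      x ∈ 𝔭.submonoid ↔ E.iso A x ∈ (e A 𝔭).submonoid

/-- **Corollary 4.10** (Category-theoreticity of the birationalization): for `D_i` of FSMFF-type and `C_i`
of quasi-isotropic type there is a `1`-unique `Ψ^birat : C₁^birat ⥤ C₂^birat` `1`-commuting with
`C_i → C_i^birat` (parameters `B_i : BiratData S_i`, Prop. 4.4); if `D_i` are slim and `C_i` of birationally
Frobenius-normalized type, the composite functors are rigid (FrdI pp. 90–91).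
[cite: MochizukiFrdI2008, Cor. 4.10 p.90] -/
def Cor410 (B₁ : S₁.BiratData) (B₂ : S₂.BiratData) : Prop :=
  IsOfFSMFFType D₁ → IsOfFSMFFType D₂ → S₁.IsOfQuasiIsotropicType → S₂.IsOfQuasiIsotropicType →
    ∃ Ψbirat : B₁.Birat ⥤ B₂.Birat, OneUniqueSquare Ψ.functor B₁.toBirat B₂.toBirat Ψbirat ∧
      (IsSlim D₁ → IsSlim D₂ → IsOfBiratFrobeniusNormalizedType B₁ → IsOfBiratFrobeniusNormalizedType B₂ →
        IsRigidFunctor (Ψ.functor ⋙ B₂.toBirat) ∧ IsRigidFunctor (B₁.toBirat ⋙ Ψbirat))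

/-- The hypotheses of Cor. 4.11: `D_i` Div-slim (and `Φ_i` perf-factorial, §2, added by the wrapper), `C_i`
of standard type, and `HypB` (FrdI p. 91). [cite: MochizukiFrdI2008, Cor. 4.11 p.91] -/
@[mk_iff] structure Cor411Setting : Prop where
  /-- `D₁, D₂` Div-slim -/
  divSlim : S₁.IsDivSlim ∧ S₂.IsDivSlim
  /-- `C₁, C₂` of standard type -/
  standard : S₁.IsOfStandardType ∧ S₂.IsOfStandardType
  /-- if group-like: `Ψ` and a quasi-inverse preserve base-isomorphisms -/
  hypB : HypB S₁ S₂ Ψ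

/-- **Corollary 4.11 (i)**: there is a `1`-unique `Ψ^un-tr : C₁^un-tr ⥤ C₂^un-tr` `1`-commuting with the
projections `C_i^istr → C_i^un-tr` and `Ψ^istr` (the restriction of `Ψ` to `C₁^istr`, Thm. 3.4 (i); a
parameter); each composite functor is rigid (FrdI p. 91). [cite: MochizukiFrdI2008, Cor. 4.11 (i) p.91] -/
def Cor411i (Ψistr : S₁.Istr ⥤ S₂.Istr) : Prop :=
  Cor411Setting S₁ S₂ Ψ →
    ∃ Ψuntr : S₁.Untr ⥤ S₂.Untr, OneUniqueSquare Ψistr S₁.toUntr S₂.toUntr Ψuntr ∧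
      IsRigidFunctor (Ψistr ⋙ S₂.toUntr) ∧ IsRigidFunctor (S₁.toUntr ⋙ Ψuntr)

/-- **Corollary 4.11 (ii)**: there is a `1`-unique `Ψ^Base : D₁ ⥤ D₂` `1`-commuting with the projections
`C_i → D_i`; if `D₁, D₂` are slim each composite functor is rigid (FrdI pp. 91–92). (Rem. 4.11.1: "at least
when the divisorial monoids involved are perf-factorial, [this] constitutes a substantial strengthening of
Theorem 3.4, (v)", slim ⇒ Div-slim.) [cite: MochizukiFrdI2008, Cor. 4.11 (ii) p.91] -/
def Cor411ii : Prop :=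
  Cor411Setting S₁ S₂ Ψ →
    ∃ ΨBase : D₁ ⥤ D₂, OneUniqueSquare Ψ.functor S₁.base S₂.base ΨBase ∧
      (IsSlim D₁ → IsSlim D₂ → IsRigidFunctor (Ψ.functor ⋙ S₂.base) ∧ IsRigidFunctor (S₁.base ⋙ ΨBase))

/-- An isomorphism of functors `Ψ^Φ : Φ₁ ⥲ Φ₂` on the BASE categories lying over `Ψ^Base : D₁ ⥤ D₂`
(FrdI Cor. 4.11 (iii) p. 92: "[where we regard … `Φ_i : D_i → Mon` as a functor on `D_i`] lying over the
equivalence `Ψ^Base`"): monoid isomorphisms `Φ₁(X) ≃ Φ₂(Ψ^Base X)` natural in `X ∈ Ob(D₁)`. Together with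
`Ψ^Base` this is exactly the data of the induced equivalence `Ψ^F : F_{Φ₁} ⥲ F_{Φ₂}` of elementary
Frobenioids (Def. 1.1 (iii)). [cite: MochizukiFrdI2008, Cor. 4.11 (iii) p.92] -/
structure DivisorMonoidIsoOverBase (ΨBase : D₁ ⥤ D₂) where
  /-- the component at `X ∈ Ob(D₁)` -/
  iso : ∀ X : D₁, S₁.Mon X ≃* S₂.Mon (ΨBase.obj X)
  /-- naturality with respect to pull-backs -/
  natural : ∀ ⦃X Y : D₁⦄ (f : Y ⟶ X) (x : S₁.Mon X),
    iso Y (S₁.pull f x) = S₂.pull (ΨBase.map f) (iso X x)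

/-- **Corollary 4.11 (iii)**: if moreover `C₁, C₂` are of rationally standard type (over `R_i : RSParams S_i`), there
is an isomorphism of functors `Ψ^Φ : Φ₁ ⥲ Φ₂` lying over the `Ψ^Base` of (ii), compatible (isotropic, not
group-like case) with `Ψ^Prime`; "in particular, `Ψ^Base`, `Ψ^Φ` induce an equivalence `Ψ^F : F_{Φ₁} ⥲ F_{Φ₂}`"
— the pair `(Ψ^Base, Ψ^Φ)` (FrdI p. 92). [cite: MochizukiFrdI2008, Cor. 4.11 (iii) p.92] -/
def Cor411iii (R₁ : S₁.RSParams) (R₂ : S₂.RSParams) : Prop :=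
  Cor411Setting S₁ S₂ Ψ → S₁.IsOfRationallyStandardType R₁ → S₂.IsOfRationallyStandardType R₂ →
    ∃ ΨBase : D₁ ⥤ D₂, OneUniqueSquare Ψ.functor S₁.base S₂.base ΨBase ∧
      Nonempty (DivisorMonoidIsoOverBase S₁ S₂ ΨBase)

/-- **Corollary 4.11 (iii)**, compatibility clause (typed, v3; referee I2 LOW-1): `Ψ^Φ` "is compatible [when the
`C_i` are of isotropic, but not of group-like type] with the isomorphism `Ψ^Prime` of Theorem 4.2, (ii)" (FrdI
p. 92) — the `D`-level twin of `Thm49_compat`: `Ψ^Φ_X` maps the submonoid `Φ₁(X)_𝔭` onto `Φ₂(Ψ^Base X)_{Ψ^Prime(𝔭)}`,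
for the data `(Ψ^Base, Ψ^Φ)` of `Cor411iii` and the bijections of primes `e` induced by `Ψ^Prime` (parameters).
[cite: MochizukiFrdI2008, Cor. 4.11 (iii) p.92] -/
def Cor411iii_compat {ΨBase : D₁ ⥤ D₂} (E : DivisorMonoidIsoOverBase S₁ S₂ ΨBase)
    (e : ∀ X : D₁, Primes (S₁.Mon X) ≃ Primes (S₂.Mon (ΨBase.obj X))) : Prop :=
  S₁.IsOfIsotropicType → S₂.IsOfIsotropicType → ¬ S₁.IsOfGroupLikeType → ¬ S₂.IsOfGroupLikeType →
    ∀ (X : D₁) (𝔭 : Primes (S₁.Mon X)) (x : S₁.Mon X), x ∈ 𝔭.submonoid ↔ E.iso X x ∈ (e X 𝔭).submonoid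

/-- **Corollary 4.11 (iv)** (Category-theoreticity of the functor to an elementary Frobenioid): if `C₁, C₂`
are of rationally standard type there is a `1`-commutative diagram `Ψ^F ∘ (C₁ → F_{Φ₁}) ≅ (C₂ → F_{Φ₂}) ∘ Ψ`
(FrdI p. 92). In operations form: there are `Ψ^Base`, `Ψ^Φ` over it and an isomorphism
`η : Base₂ ∘ Ψ ≅ Ψ^Base ∘ Base₁` such that `Ψ` preserves Frobenius degrees and `Div(Ψ φ) = η_A^* (Ψ^Φ (Div φ))`
for every `φ : A → B` of `C₁` — i.e. `Ψ` carries `(Base, Div, deg_Fr)` of `C₁` to that of `C₂`; and (the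
rigidity clause of (ii), carried here UNDER ITS PREMISE "if `D₁, D₂` are slim") the `D`-valued composites
`Base₂ ∘ Ψ`, `Ψ^Base ∘ Base₁` are rigid. v2 (FLAG #15, finding D6-F2 of abc-iut-L1-d6, L1-lead ruling
2026-08-25T21:13:25Z (A)): v1 asserted the last two conjuncts WITHOUT the slimness premise — not print's
clause (print's (iv) rigidity concerns the `F_Φ`-valued composites, typed separately as `Cor411ivRigid`) and
false as typed (d6's counter-model: `D = B(ℤ/2)` Div-slim but not slim, `Φ = ℕ²` with the factors swapped,
`Ψ = id`). [cite: MochizukiFrdI2008, Cor. 4.11 (iv) p.92] -/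
def Cor411iv (R₁ : S₁.RSParams) (R₂ : S₂.RSParams) : Prop :=
  Cor411Setting S₁ S₂ Ψ → S₁.IsOfRationallyStandardType R₁ → S₂.IsOfRationallyStandardType R₂ →
    ∃ (ΨBase : D₁ ⥤ D₂) (E : DivisorMonoidIsoOverBase S₁ S₂ ΨBase)
      (η : Ψ.functor ⋙ S₂.base ≅ S₁.base ⋙ ΨBase),
      ΨBase.IsEquivalence ∧ PreservesDegFr S₁ S₂ Ψ ∧
        (∀ ⦃A B : C₁⦄ (φ : A ⟶ B),
          S₂.div (Ψ.functor.map φ) = S₂.pull (η.hom.app A) (E.iso (S₁.base.obj A) (S₁.div φ))) ∧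
        (IsSlim D₁ → IsSlim D₂ → IsRigidFunctor (Ψ.functor ⋙ S₂.base) ∧ IsRigidFunctor (S₁.base ⋙ ΨBase))

/-- **Corollary 4.11 (iv)**, rigidity clause: "Moreover, each of the composite functors [`C₁ → F_{Φ₂}`] of this
diagram is rigid" (FrdI p. 92; NO slimness premise — proof p. 94 "via the same argument as … (i)", i.e.
Div-slimness of `D_i` kills natural automorphisms acting trivially on `Φ`). Operations form (v2, FLAG #15):
since `Φ₂` is divisorial, hence sharp, an automorphism in `F_{Φ₂}` of an object `X` is `(β, 1, 0)` with
`β ∈ Aut_{D₂}(X)`, and by Rem. 1.1.1 a family `(α_A)` is a natural automorphism of the composite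
`Ψ ⋙ (C₂ → F_{Φ₂})`, resp. `(C₁ → F_{Φ₁}) ⋙ Ψ^F`, iff it is a natural automorphism of the `D₂`-valued functor
`Base₂ ∘ Ψ`, resp. `Ψ^Base ∘ Base₁`, whose components FIX THE DIVISORS of all arrows: `α_A^* Div₂(Ψ φ) = Div₂(Ψ φ)`,
resp. `α_A^* Ψ^Φ(Div₁ φ) = Ψ^Φ(Div₁ φ)`, for every `φ : A → B`. Typed for the data `(Ψ^Base, Ψ^Φ)` of `Cor411iv`
(parameters). [cite: MochizukiFrdI2008, Cor. 4.11 (iv) p.92] -/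
def Cor411ivRigid (ΨBase : D₁ ⥤ D₂) (E : DivisorMonoidIsoOverBase S₁ S₂ ΨBase) : Prop :=
  Cor411Setting S₁ S₂ Ψ →
    (∀ α : Ψ.functor ⋙ S₂.base ≅ Ψ.functor ⋙ S₂.base,
        (∀ ⦃A B : C₁⦄ (φ : A ⟶ B),
            S₂.pull (α.hom.app A) (S₂.div (Ψ.functor.map φ)) = S₂.div (Ψ.functor.map φ)) →
          α = Iso.refl _) ∧
      (∀ α : S₁.base ⋙ ΨBase ≅ S₁.base ⋙ ΨBase,
        (∀ ⦃A B : C₁⦄ (φ : A ⟶ B),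
            S₂.pull (α.hom.app A) (E.iso (S₁.base.obj A) (S₁.div φ)) = E.iso (S₁.base.obj A) (S₁.div φ)) →
          α = Iso.refl _)

/-- **Corollary 4.12** (Category-theoreticity of the functor to an elementary Frobenioid II): for `D_i`
Frobenius-slim, `C_i` of rationally standard type (over `R_i : RSParams S_i`) and `HypB`, there is a `1`-unique
`Ψ⁰ : F_{0_{D₁}} ⥤ F_{0_{D₂}}` `1`-commuting with the projections `C_i → F_{0_{D_i}} = D_i × N_{≥1}`
(`toBaseDeg`); if `D₁, D₂` are slim each composite functor is rigid (FrdI pp. 94–95).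
[cite: MochizukiFrdI2008, Cor. 4.12 p.95] -/
def Cor412 (R₁ : S₁.RSParams) (R₂ : S₂.RSParams) : Prop :=
  IsFrobeniusSlim D₁ → IsFrobeniusSlim D₂ → S₁.IsOfRationallyStandardType R₁ → S₂.IsOfRationallyStandardType R₂ →
    HypB S₁ S₂ Ψ →
    ∃ Ψ0 : D₁ × SingleObj ℕ+ ⥤ D₂ × SingleObj ℕ+,
      OneUniqueSquare Ψ.functor S₁.toBaseDeg S₂.toBaseDeg Ψ0 ∧
        (IsSlim D₁ → IsSlim D₂ →
          IsRigidFunctor (Ψ.functor ⋙ S₂.toBaseDeg) ∧ IsRigidFunctor (S₁.toBaseDeg ⋙ Ψ0))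

end PreFrobenioidData

end Literature.AlgebraicGeometry.Frobenioids
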